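import Mathlib
import HarnessLib
import Summits.PneNP.PneNP.Theorems.CnfIdealGenLengthRankDefectRepresentationsFamilyCutLemma

/-!
# Good blocks: after the family cut lemma, all but `O(r)` blocks are EXACTLY exact (crux `RankDefectRepresentations` =
# stmt-PneNP-18923, line `cell-union-merge`; lead g18)

Input of the one open stub `stub_blockExactification` (BE) of `Lines/cell_union_merge.lean` (RESHAPE g18): a complete
orthogonal system `P : X → K^{d×d}`, matrices `G_y` commuting with every `P_x`, and a frame `U : d×r`, `W : r×d` such that
`Q_y = G_y + U α_y + β_y W` are orthogonal idempotents (this is what `…FamilyCutLemma.familyCutLemma` delivers).  THEOREM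
(`goodBlocks`): all but at most `8r` blocks `x` of `P` carry an EXACTLY exact compressed family — `P_x G_y` are idempotents,
pairwise orthogonal (`y ≠ y'`).  So the exactification half of AMB is concentrated on `O(r)` "bad" blocks (memo
`Lines/cell-union-merge-g18.md` §4(b),(e)).

Proof (generic-point counting, no probability): for weights `λ : Y → K` put `G(λ) = ∑ λ_y G_y`, `Δ(λ) = G(λ)² − G(λ²)`.
Since `Q(λ)² = Q(λ²)` and `G = Q − N` with `N(λ) = U(∑λ_yα_y) + (∑λ_yβ_y)W` of rank `≤ 2r`, `rank Δ(λ) ≤ 8r` for EVERY `λ`.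
A bad block `x` has `P_x Δ(λ) ≠ 0` for `λ = 1_{y}` (a non-idempotent `P_xG_y`) or `λ = 1_{y,y'}` (idempotent but not
orthogonal: anticommuting idempotents are orthogonal in characteristic `≠ 2`), hence the polynomial matrix `P_x Δ(s)` over
`K[s]` is nonzero; at a common non-root `s₀` of one nonzero entry per bad block (`K` infinite), the vectors `P_x Δ(s₀) v_x ≠ 0`
lie in `im Δ(s₀)` and in the independent subspaces `im P_x`, so `#bad ≤ rank Δ(s₀) ≤ 8r`.
HONEST FRAMING: negative-lane tool; BE/AMB stay open; P ≠ NP is not moved; F-N2 is a FRONTIER formal rung.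
-/

set_option linter.dupNamespace false -- `Summit.PneNP.PneNP.…`: summit = sub-problem name (D-0017)

namespace Summit.PneNP.PneNP.Theorems.CnfIdealGenLengthRankDefectRepresentationsGoodBlocks

open Matrix Module MvPolynomial
open Summit.PneNP.PneNP.Theorems.CnfIdealGenLengthRankDefectRepresentationsFamilyCutLemma
  (map_smul_hom exists_eval_ne_zero rank_mul_le_inner)
open Summit.PneNP.PneNP.Theorems.CnfIdealGenLengthRankDefectRepresentationsMergeLowerBound (rank_add_le' rank_sub_le' rank_neg')

variable {K : Type} [Field K] {d : ℕ}

section Algebra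

variable {Y : Type} [Fintype Y] [DecidableEq Y]

omit [DecidableEq Y] in
/-- Weighted sums of orthogonal idempotents square weight-wise: `(∑ λ_y Q_y)² = ∑ λ_y² Q_y`. [folklore] -/
theorem weightedSum_sq (Q : Y → Matrix (Fin d) (Fin d) K) (hQi : ∀ y, Q y * Q y = Q y)
    (hQo : ∀ y y', y ≠ y' → Q y * Q y' = 0) (lam : Y → K) :
    (∑ y, lam y • Q y) * (∑ y, lam y • Q y) = ∑ y, (lam y * lam y) • Q y := by
  rw [Finset.sum_mul_sum]
  refine Finset.sum_congr rfl fun y _ => ?_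
  rw [Finset.sum_eq_single y]
  · rw [Matrix.smul_mul, Matrix.mul_smul, smul_smul, hQi]
  · intro y' _ hy'
    rw [Matrix.smul_mul, Matrix.mul_smul, hQo y y' (Ne.symm hy'), smul_zero, smul_zero]
  · intro h; exact absurd (Finset.mem_univ y) h

omit [DecidableEq Y] in
/-- The frame part of a weighted sum has rank `≤ 2r`. [folklore] -/
theorem rank_weightedSum_frame_le {r : ℕ} (U : Matrix (Fin d) (Fin r) K) (W : Matrix (Fin r) (Fin d) K)
    (α : Y → Matrix (Fin r) (Fin d) K) (β : Y → Matrix (Fin d) (Fin r) K) (lam : Y → K) :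
    (∑ y, lam y • (U * α y + β y * W)).rank ≤ 2 * r := by
  have h : ∑ y, lam y • (U * α y + β y * W) = U * (∑ y, lam y • α y) + (∑ y, lam y • β y) * W := by
    rw [Matrix.mul_sum, Matrix.sum_mul, ← Finset.sum_add_distrib]
    refine Finset.sum_congr rfl fun y _ => ?_
    rw [smul_add, Matrix.mul_smul, Matrix.smul_mul]
  rw [h]
  calc (U * (∑ y, lam y • α y) + (∑ y, lam y • β y) * W).rank
      ≤ (U * (∑ y, lam y • α y)).rank + ((∑ y, lam y • β y) * W).rank := rank_add_le' _ _
    _ ≤ r + r := Nat.add_le_add (rank_mul_le_inner _ _) (rank_mul_le_inner _ _)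
    _ = 2 * r := by ring

omit [DecidableEq Y] in
/-- **The defect of a weighted sum has rank `≤ 8r`.**  With `G_y = Q_y − N_y`, `Q` orthogonal idempotents and `N` in a frame
of cost `r`: `rank ((∑ λ_y G_y)² − ∑ λ_y² G_y) ≤ 8r`. -/
theorem rank_defect_le {r : ℕ} (Q G : Y → Matrix (Fin d) (Fin d) K) (U : Matrix (Fin d) (Fin r) K)
    (W : Matrix (Fin r) (Fin d) K) (α : Y → Matrix (Fin r) (Fin d) K) (β : Y → Matrix (Fin d) (Fin r) K)
    (hQi : ∀ y, Q y * Q y = Q y) (hQo : ∀ y y', y ≠ y' → Q y * Q y' = 0)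
    (hQ : ∀ y, Q y = G y + U * α y + β y * W) (lam : Y → K) :
    ((∑ y, lam y • G y) * (∑ y, lam y • G y) - ∑ y, (lam y * lam y) • G y).rank ≤ 8 * r := by
  set N : Y → Matrix (Fin d) (Fin d) K := fun y => U * α y + β y * W with hN
  have hG : ∀ y, G y = Q y - N y := fun y => by rw [hQ y, hN]; simp only; abel
  set QQ := ∑ y, lam y • Q y with hQQ
  set NN := ∑ y, lam y • N y with hNN
  set N2 := ∑ y, (lam y * lam y) • N y with hN2
  have hGs : ∑ y, lam y • G y = QQ - NN := by
    rw [hQQ, hNN, ← Finset.sum_sub_distrib]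
    exact Finset.sum_congr rfl fun y _ => by rw [hG, smul_sub]
  have hG2 : ∑ y, (lam y * lam y) • G y = QQ * QQ - N2 := by
    rw [hQQ, weightedSum_sq Q hQi hQo lam, hN2, ← Finset.sum_sub_distrib]
    exact Finset.sum_congr rfl fun y _ => by rw [hG, smul_sub]
  have key : (∑ y, lam y • G y) * (∑ y, lam y • G y) - ∑ y, (lam y * lam y) • G y =
      N2 - QQ * NN - NN * QQ + NN * NN := by
    rw [hGs, hG2]
    simp only [Matrix.sub_mul, Matrix.mul_sub]
    abel
  rw [key]
  have h1 : N2.rank ≤ 2 * r := rank_weightedSum_frame_le U W α β _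
  have h2 : NN.rank ≤ 2 * r := rank_weightedSum_frame_le U W α β _
  calc (N2 - QQ * NN - NN * QQ + NN * NN).rank
      ≤ (N2 - QQ * NN - NN * QQ).rank + (NN * NN).rank := rank_add_le' _ _
    _ ≤ ((N2 - QQ * NN).rank + (NN * QQ).rank) + (NN * NN).rank :=
        Nat.add_le_add_right (rank_sub_le' _ _) _
    _ ≤ ((N2.rank + (QQ * NN).rank) + (NN * QQ).rank) + (NN * NN).rank :=
        Nat.add_le_add_right (Nat.add_le_add_right (rank_sub_le' _ _) _) _
    _ ≤ ((2 * r + 2 * r) + 2 * r) + 2 * r :=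
        Nat.add_le_add (Nat.add_le_add (Nat.add_le_add h1 ((Matrix.rank_mul_le_right _ _).trans h2))
          ((Matrix.rank_mul_le_left _ _).trans h2)) ((Matrix.rank_mul_le_left _ _).trans h2)
    _ = 8 * r := by ring

/-- Anticommuting idempotents are orthogonal (characteristic `≠ 2`). [folklore] -/
theorem mul_eq_zero_of_anticomm [CharZero K] (E F : Matrix (Fin d) (Fin d) K) (hE : E * E = E)
    (h : E * F + F * E = 0) : E * F = 0 := by
  have h1 : E * F = -(F * E) := eq_neg_of_add_eq_zero_left h
  have h2 : E * F = -(E * F * E) := by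
    calc E * F = E * E * F := by rw [hE]
      _ = E * (E * F) := by rw [Matrix.mul_assoc]
      _ = E * -(F * E) := by rw [← h1]
      _ = -(E * F * E) := by rw [Matrix.mul_neg, Matrix.mul_assoc]
  have h3 : E * F * E = -(F * E) := by
    calc E * F * E = -(F * E) * E := by rw [← h1]
      _ = -(F * (E * E)) := by rw [Matrix.neg_mul, Matrix.mul_assoc]
      _ = -(F * E) := by rw [hE]
  have h4 : E * F = F * E := by rw [h2, h3, neg_neg]
  have h5 : (2 : K) • (E * F) = 0 := by rw [two_smul]; nth_rw 2 [h4]; exact h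
  exact (smul_eq_zero.mp h5).resolve_left two_ne_zero

end Algebra

section Main

variable [CharZero K] {X Y : Type} [Fintype X] [Fintype Y] [DecidableEq X] [DecidableEq Y]

omit [CharZero K] [Fintype Y] [DecidableEq Y] in
/-- **Counting lemma.**  If `P` is an orthogonal family of idempotents and `M` commutes with every `P_x`, then the number
of cells `x` with `P_x M ≠ 0` is at most `rank M`: nonzero columns of the `P_x M = M P_x` are vectors of `im M` lying in the
independent subspaces `im P_x`. [folklore] -/
theorem card_filter_mul_ne_zero_le_rank (P : X → Matrix (Fin d) (Fin d) K) (M : Matrix (Fin d) (Fin d) K)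
    (hPi : ∀ x, P x * P x = P x) (hPo : ∀ x x', x ≠ x' → P x * P x' = 0) (hM : ∀ x, M * P x = P x * M) :
    ∃ T : Finset X, T.card ≤ M.rank ∧ ∀ x ∉ T, P x * M = 0 := by
  classical
  set T : Finset X := Finset.univ.filter fun x => P x * M ≠ 0 with hT
  refine ⟨T, ?_, fun x hx => ?_⟩
  swap
  · by_contra h
    exact hx (Finset.mem_filter.mpr ⟨Finset.mem_univ x, h⟩)
  have hT' : ∀ x : T, ∃ ij : Fin d × Fin d, (P x * M) ij.1 ij.2 ≠ 0 := by
    rintro ⟨x, hx⟩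
    have hx' : P x * M ≠ 0 := (Finset.mem_filter.mp hx).2
    by_contra hcon
    apply hx'
    ext i j
    rw [Matrix.zero_apply]
    by_contra hne
    exact hcon ⟨(i, j), hne⟩
  choose ij hij using hT'
  let w : T → (Fin d → K) := fun x => (P x * M) *ᵥ Pi.single (ij x).2 1
  have hw_ne : ∀ x : T, w x ≠ 0 := by
    intro x h
    apply hij x
    have := congrFun h (ij x).1
    rw [Pi.zero_apply] at this
    rw [← this]
    show (P x * M) (ij x).1 (ij x).2 = ((P x * M) *ᵥ Pi.single (ij x).2 1) (ij x).1
    rw [Matrix.mulVec_single_one]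
    rfl
  have hPw : ∀ (x : T) (x' : X), P x' *ᵥ w x = if x' = x then w x else 0 := by
    intro x x'
    show P x' *ᵥ (P x * M) *ᵥ Pi.single (ij x).2 1 = _
    rw [Matrix.mulVec_mulVec, ← Matrix.mul_assoc]
    by_cases h : x' = x
    · rw [h, hPi, if_pos rfl]
    · rw [hPo x' x h, Matrix.zero_mul, Matrix.zero_mulVec, if_neg h]
  have hw_mem : ∀ x : T, w x ∈ LinearMap.range M.mulVecLin := by
    intro x
    refine ⟨(P x).mulVec (Pi.single (ij x).2 1), ?_⟩
    show M *ᵥ (P x *ᵥ Pi.single (ij x).2 1) = (P x * M) *ᵥ Pi.single (ij x).2 1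
    rw [Matrix.mulVec_mulVec, hM]
  let S : Submodule K (Fin d → K) := LinearMap.range M.mulVecLin
  let v : T → S := fun x => ⟨w x, hw_mem x⟩
  have hlin : LinearIndependent K v := by
    have hcomp : LinearIndependent K (S.subtype ∘ v) := by
      rw [linearIndependent_iff']
      intro s c hc x₀ hx₀
      have h := congrArg (fun u => P (x₀ : X) *ᵥ u) hc
      simp only [Function.comp_apply, Submodule.subtype_apply, Matrix.mulVec_zero] at h
      rw [Matrix.mulVec_sum] at h
      have h' : ∑ x ∈ s, c x • (P (x₀ : X) *ᵥ w x) = 0 := by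
        rw [← h]
        exact Finset.sum_congr rfl fun x _ => by rw [Matrix.mulVec_smul]
      rw [Finset.sum_eq_single x₀] at h'
      · rw [hPw, if_pos rfl] at h'
        exact (smul_eq_zero.mp h').resolve_right (hw_ne x₀)
      · intro x _ hx
        have hne : (x₀ : X) ≠ (x : X) := fun h => hx (Subtype.ext h).symm
        rw [hPw, if_neg hne, smul_zero]
      · intro h; exact absurd hx₀ h
    exact LinearIndependent.of_comp _ hcomp
  have hcard : Fintype.card T ≤ finrank K S := hlin.fintype_card_le_finrank
  have : finrank K S = M.rank := rfl
  rw [Fintype.card_coe] at hcard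
  exact hcard.trans this.le

/-- **GOOD BLOCKS.**  If `P` is a complete orthogonal system of idempotents, every `G_y` commutes with every `P_x`, and
`Q_y = G_y + U α_y + β_y W` (`U : d × r`, `W : r × d`) are orthogonal idempotents, then outside a set of at most `8r` blocks
`x` the compressed family `(P_x G_y)_y` consists of pairwise orthogonal idempotents. -/
theorem goodBlocks (P : X → Matrix (Fin d) (Fin d) K) (Q G : Y → Matrix (Fin d) (Fin d) K) (r : ℕ)
    (U : Matrix (Fin d) (Fin r) K) (W : Matrix (Fin r) (Fin d) K)
    (α : Y → Matrix (Fin r) (Fin d) K) (β : Y → Matrix (Fin d) (Fin r) K)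
    (hPi : ∀ x, P x * P x = P x) (hPo : ∀ x x', x ≠ x' → P x * P x' = 0)
    (hQi : ∀ y, Q y * Q y = Q y) (hQo : ∀ y y', y ≠ y' → Q y * Q y' = 0)
    (hGP : ∀ x y, G y * P x = P x * G y) (hQ : ∀ y, Q y = G y + U * α y + β y * W) :
    ∃ S : Finset X, S.card ≤ 8 * r ∧ ∀ x ∉ S,
      (∀ y, P x * G y * (P x * G y) = P x * G y) ∧ (∀ y y', y ≠ y' → P x * G y * (P x * G y') = 0) := by
  classical
  -- the defect matrix at weights `lam`
  let Δ : (Y → K) → Matrix (Fin d) (Fin d) K := fun lam =>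
    (∑ y, lam y • G y) * (∑ y, lam y • G y) - ∑ y, (lam y * lam y) • G y
  have hΔrank : ∀ lam, (Δ lam).rank ≤ 8 * r := fun lam => rank_defect_le Q G U W α β hQi hQo hQ lam
  have hGsP : ∀ (lam : Y → K) x, (∑ y, lam y • G y) * P x = P x * ∑ y, lam y • G y := by
    intro lam x
    rw [Finset.sum_mul, Finset.mul_sum]
    exact Finset.sum_congr rfl fun y _ => by rw [Matrix.smul_mul, Matrix.mul_smul, hGP]
  have hΔP : ∀ lam x, Δ lam * P x = P x * Δ lam := by
    intro lam x
    show ((∑ y, lam y • G y) * (∑ y, lam y • G y) - ∑ y, (lam y * lam y) • G y) * P x =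
      P x * ((∑ y, lam y • G y) * (∑ y, lam y • G y) - ∑ y, (lam y * lam y) • G y)
    rw [Matrix.sub_mul, Matrix.mul_sub, Matrix.mul_assoc, hGsP, ← Matrix.mul_assoc, hGsP, Matrix.mul_assoc,
      hGsP (fun y => lam y * lam y)]
  have hprod : ∀ x y y', P x * G y * (P x * G y') = P x * (G y * G y') := by
    intro x y y'
    calc P x * G y * (P x * G y') = P x * ((G y * P x) * G y') := by simp only [Matrix.mul_assoc]
      _ = P x * ((P x * G y) * G y') := by rw [hGP]
      _ = (P x * P x) * (G y * G y') := by simp only [Matrix.mul_assoc]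
      _ = P x * (G y * G y') := by rw [hPi]
  -- "good" blocks
  let good : X → Prop := fun x => (∀ y, P x * (G y * G y - G y) = 0) ∧ ∀ y y', y ≠ y' → P x * (G y * G y') = 0
  -- a bad block sees a nonzero defect at some 0/1 weight
  have hbad : ∀ x, ¬ good x → ∃ lam : Y → K, P x * Δ lam ≠ 0 := by
    intro x hx
    by_cases ha : ∀ y, P x * (G y * G y - G y) = 0
    · -- idempotent compressed cells, some pair not orthogonal
      have hb : ∃ y y', y ≠ y' ∧ P x * (G y * G y') ≠ 0 := by
        by_contra hcon
        apply hx
        refine ⟨ha, fun y y' hyy' => ?_⟩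
        by_contra hne
        exact hcon ⟨y, y', hyy', hne⟩
      obtain ⟨y₀, y₁, hne, hb⟩ := hb
      refine ⟨fun y => if y = y₀ ∨ y = y₁ then 1 else 0, ?_⟩
      have hsum : ∀ (f : Y → Matrix (Fin d) (Fin d) K),
          ∑ y, (if y = y₀ ∨ y = y₁ then (1 : K) else 0) • f y = f y₀ + f y₁ := by
        intro f
        have : ∀ y, (if y = y₀ ∨ y = y₁ then (1 : K) else 0) • f y =
            (if y = y₀ then f y₀ else 0) + (if y = y₁ then f y₁ else 0) := by
          intro y
          by_cases h0 : y = y₀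
          · subst h0; simp [hne]
          · by_cases h1 : y = y₁
            · subst h1; simp [h0]
            · simp [h0, h1]
        simp_rw [this]
        rw [Finset.sum_add_distrib, Finset.sum_ite_eq' Finset.univ y₀, Finset.sum_ite_eq' Finset.univ y₁]
        simp
      have hsq : ∀ y, ((if y = y₀ ∨ y = y₁ then (1 : K) else 0) * if y = y₀ ∨ y = y₁ then (1 : K) else 0) =
          if y = y₀ ∨ y = y₁ then (1 : K) else 0 := fun y => by split_ifs <;> simp
      intro hzero
      apply hb
      -- `P_x Δ = P_x (G₀G₁ + G₁G₀)` and anticommuting idempotents are orthogonal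
      have hE : P x * G y₀ * (P x * G y₀) = P x * G y₀ := by
        have := ha y₀
        rw [Matrix.mul_sub, sub_eq_zero] at this
        rw [hprod, this]
      have hΔval : P x * Δ (fun y => if y = y₀ ∨ y = y₁ then 1 else 0) =
          P x * (G y₀ * G y₁) + P x * (G y₁ * G y₀) := by
        show P x * ((∑ y, (if y = y₀ ∨ y = y₁ then (1 : K) else 0) • G y) *
            (∑ y, (if y = y₀ ∨ y = y₁ then (1 : K) else 0) • G y) -
            ∑ y, ((if y = y₀ ∨ y = y₁ then (1 : K) else 0) * if y = y₀ ∨ y = y₁ then (1 : K) else 0) • G y) = _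
        simp_rw [hsq]
        rw [hsum]
        have e : (G y₀ + G y₁) * (G y₀ + G y₁) - (G y₀ + G y₁) =
            (G y₀ * G y₀ - G y₀) + (G y₁ * G y₁ - G y₁) + G y₀ * G y₁ + G y₁ * G y₀ := by
          simp only [Matrix.add_mul, Matrix.mul_add]; abel
        rw [e, Matrix.mul_add, Matrix.mul_add, Matrix.mul_add, ha y₀, ha y₁, zero_add, zero_add]
      rw [hΔval] at hzero
      -- E := P x * G y₀, F := P x * G y₁ (as products with P x): E F + F E = 0
      have hEF : P x * G y₀ * (P x * G y₁) + P x * G y₁ * (P x * G y₀) = 0 := by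
        rw [hprod, hprod]
        exact hzero
      have h0 := mul_eq_zero_of_anticomm (P x * G y₀) (P x * G y₁) hE hEF
      rw [hprod] at h0
      exact h0
    · push Not at ha
      obtain ⟨y₀, hy₀⟩ := ha
      refine ⟨fun y => if y = y₀ then 1 else 0, ?_⟩
      have hsum : ∀ (f : Y → Matrix (Fin d) (Fin d) K), ∑ y, (if y = y₀ then (1 : K) else 0) • f y = f y₀ := by
        intro f
        have : ∀ y, (if y = y₀ then (1 : K) else 0) • f y = if y = y₀ then f y₀ else 0 := by
          intro y; by_cases h : y = y₀
          · subst h; simp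
          · simp [h]
        simp_rw [this]
        rw [Finset.sum_ite_eq' Finset.univ y₀]; simp
      have hsq : ∀ y, ((if y = y₀ then (1 : K) else 0) * if y = y₀ then (1 : K) else 0) =
          if y = y₀ then (1 : K) else 0 := fun y => by split_ifs <;> simp
      show P x * ((∑ y, (if y = y₀ then (1 : K) else 0) • G y) * (∑ y, (if y = y₀ then (1 : K) else 0) • G y) -
        ∑ y, ((if y = y₀ then (1 : K) else 0) * if y = y₀ then (1 : K) else 0) • G y) ≠ 0
      simp_rw [hsq]
      rw [hsum]
      exact hy₀
  -- polynomial version of the defect: `ΔR` over `R = K[s]`, whose evaluations are the `Δ lam`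
  let R := MvPolynomial Y K
  let κ : K →+* R := MvPolynomial.C
  let GR : Y → Matrix (Fin d) (Fin d) R := fun y => (G y).map κ
  let ΔR : Matrix (Fin d) (Fin d) R :=
    (∑ y, (MvPolynomial.X y : R) • GR y) * (∑ y, (MvPolynomial.X y : R) • GR y) -
      ∑ y, ((MvPolynomial.X y : R) * MvPolynomial.X y) • GR y
  have hevκ : ∀ (lam : Y → K) (M : Matrix (Fin d) (Fin d) K), (M.map κ).map (MvPolynomial.eval lam) = M := by
    intro lam M; ext i j; simp only [Matrix.map_apply]; exact MvPolynomial.eval_C _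
  have hev : ∀ lam : Y → K, ΔR.map (MvPolynomial.eval lam) = Δ lam := by
    intro lam
    have hε : ∀ M : Matrix (Fin d) (Fin d) R, M.map (MvPolynomial.eval lam) = (MvPolynomial.eval lam).mapMatrix M :=
      fun M => rfl
    show ((∑ y, (MvPolynomial.X y : R) • GR y) * (∑ y, (MvPolynomial.X y : R) • GR y) -
      ∑ y, ((MvPolynomial.X y : R) * MvPolynomial.X y) • GR y).map (MvPolynomial.eval lam) =
      (∑ y, lam y • G y) * (∑ y, lam y • G y) - ∑ y, (lam y * lam y) • G y
    have hs1 : (∑ y, (MvPolynomial.X y : R) • GR y).map (MvPolynomial.eval lam) = ∑ y, lam y • G y := by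
      rw [Summit.PneNP.PneNP.Theorems.CnfIdealGenLengthRankDefectRepresentationsFamilyCutLemma.map_finset_sum]
      refine Finset.sum_congr rfl fun y _ => ?_
      rw [map_smul_hom, MvPolynomial.eval_X, hevκ]
    have hs2 : (∑ y, ((MvPolynomial.X y : R) * MvPolynomial.X y) • GR y).map (MvPolynomial.eval lam) =
        ∑ y, (lam y * lam y) • G y := by
      rw [Summit.PneNP.PneNP.Theorems.CnfIdealGenLengthRankDefectRepresentationsFamilyCutLemma.map_finset_sum]
      refine Finset.sum_congr rfl fun y _ => ?_
      rw [map_smul_hom, map_mul, MvPolynomial.eval_X, hevκ]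
    rw [hε, map_sub, map_mul, ← hε, ← hε, hs1, hs2]
  have hPR : ∀ (lam : Y → K) x, ((P x).map κ * ΔR).map (MvPolynomial.eval lam) = P x * Δ lam := by
    intro lam x
    rw [Matrix.map_mul, hevκ, hev]
  -- the bad set
  let bad : Finset X := Finset.univ.filter fun x => ¬ good x
  have hbadR : ∀ x : bad, ∃ ij : Fin d × Fin d, ((P x).map κ * ΔR) ij.1 ij.2 ≠ 0 := by
    rintro ⟨x, hx⟩
    have hx' : ¬ good x := (Finset.mem_filter.mp hx).2
    obtain ⟨lam, hlam⟩ := hbad x hx'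
    by_contra hcon
    apply hlam
    rw [← hPR lam x]
    ext i j
    rw [Matrix.map_apply, Matrix.zero_apply]
    have : ((P x).map κ * ΔR) i j = 0 := by
      by_contra hne
      exact hcon ⟨(i, j), hne⟩
    rw [this, map_zero]
  choose ij hij using hbadR
  -- one weight `s₀` at which every bad block's chosen entry is nonzero
  have hprodne : (∏ x : bad, ((P x).map κ * ΔR) (ij x).1 (ij x).2) ≠ 0 :=
    Finset.prod_ne_zero_iff.mpr fun x _ => hij x
  obtain ⟨s₀, hs₀⟩ := exists_eval_ne_zero hprodne
  rw [map_prod] at hs₀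
  have hs₀x : ∀ x : bad, (P x * Δ s₀) (ij x).1 (ij x).2 ≠ 0 := by
    intro x
    have h := Finset.prod_ne_zero_iff.mp hs₀ x (Finset.mem_univ x)
    rw [← hPR s₀ x, Matrix.map_apply]
    exact h
  -- count: `bad ⊆ {x : P_x Δ(s₀) ≠ 0}`, whose size is at most `rank Δ(s₀) ≤ 8r`
  obtain ⟨T, hTcard, hT⟩ := card_filter_mul_ne_zero_le_rank P (Δ s₀) hPi hPo (fun x => hΔP s₀ x)
  have hsub : bad ⊆ T := by
    intro x hx
    by_contra hxT
    apply hs₀x ⟨x, hx⟩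
    show (P x * Δ s₀) _ _ = 0
    rw [hT x hxT, Matrix.zero_apply]
  have hcard := (Finset.card_le_card hsub).trans hTcard
  refine ⟨bad, hcard.trans (hΔrank s₀), fun x hx => ?_⟩
  · have hgood : good x := by
      by_contra h
      exact hx (Finset.mem_filter.mpr ⟨Finset.mem_univ x, h⟩)
    refine ⟨fun y => ?_, fun y y' hyy' => ?_⟩
    · have := hgood.1 y
      rw [Matrix.mul_sub, sub_eq_zero] at this
      rw [hprod, this]
    · rw [hprod, hgood.2 y y' hyy']

end Main

end Summit.PneNP.PneNP.Theorems.CnfIdealGenLengthRankDefectRepresentationsGoodBlocks
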